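import Summits.QuantumFields.YangMills.Theorems.BalabanLadderIRTwistedSlabTubeTopology
import Summits.QuantumFields.YangMills.Theorems.BalabanLadderIRTwistedSlabSlicePhaseData
import Literature.Analysis.Asymptotics.LaplaceMethodOrbitCompact
import HarnessLib

/-!
# T1-TREE (one box): the `β → ∞` asymptotics of the magnetically twisted `SU(N)` slab partition function —
# `β^{m/2} · W{ω^k·1, 1}(β; box) ⟶ C(box) > 0`, by lit-4's L23 `tendsto_laplaceMethod_sum_orbits_of_continuous`
# (Laplace's method on the `N²` non-degenerate critical gauge orbits of the twist-eating ladders) fed BY NAME with K2 ∕ K7 ∕ K9 ∕ K17–K22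

HELPER toward stub **T1** `TwistedSlabAnchor` (LINE `twisted-slab-continuity`, crux `IRcof` stmt-QuantumFields-26930, census row 43;
LEAD prover ym-ir-line-tsc-p1 g4; `--supports` the crux, `--as helper`).  Sequel of `…TwistedSlabTubeTopology` (K22), `…TwistedSlabSlicePhaseData` (K19) and
lit-4's L23 `Literature/Analysis/Asymptotics/LaplaceMethodOrbitCompact`.  Proof file: theorems only, no definitions, no named facts.
* §1 `fibredChartDensity_nonneg` (the chart density is a product of absolute values and a `toReal`), `fibredChartMap_prodFrame_zero`,
  `twistedExponent_sliceCfg_eq_slicePhase` (the phase along the transversal IS K19's `slicePhase`), `setIntegral_ball_pos` (positivity bookkeeping).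
* §2 ★★★ `tendsto_laplace_sum_orbits_twistedExponent` — for `SU(N)`, a generating twist `k`, a reference pair `B A B⁻¹ A⁻¹ = ω^k·1`, a box
  `(m+1)² × (m₂+1) × (m₃+1)` with `N(m+1) ≥ 2`, a frame `T_M` of the gauge algebra and frames `T_V (i,j)` of the `N²` real Coulomb slices by one model
  `V`, and every continuous gauge-invariant amplitude `φ`:
  `β^{dim V/2} ∫ e^{−β·twistedExponent k} φ dHaar ⟶ Σ_{(i,j)} (2π)^{dim V/2} ν(𝒢) C_{ij} φ(ladder_{ij}) ∕ √det A_{ij}` with EXPLICIT orbit constants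
  (`C_{ij} = (∫_{ball ρ} J_{ij}(z,0)dz) ∕ ν(((e(ball ρ))·Z_N)⁻¹)`, `J_{ij}` = K17's fibred chart density, `A_{ij}` = K19's slice Hessian) — ONE CALL of L23 with:
  `hact`∕`hpres` = K21, `he𝓝` = K21 `nhds_one_le_map_expGauge_comp`, `hΘ'` = K18 `fibredChartMap_prodFrame`, `hΘ'𝓝` = K22
  `exists_isOpen_forall_nhds_le_map_fibredChartMap`, chart data = K20a `exists_ball_prod_hloc_ladder`, `hstab`∕`hfix` = K21, `hAs`∕`hpos`∕`hS2` = K19,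
  `hzero` = K9 `twistedExponent_eq_zero_iff` (K2), `hdist` = K2 `ladder_pair_labels_unique_specialUnitary` + K21 `suCenter_coe_injective`.
* §3 ★★★ `tendsto_rpow_mul_twistedPartition_slab` — through K9's `rfl` link: `β^{dim V/2} · wilsonFinTorusTensorTwistedPartition (fundamentalRep (Fin N)) β
  (slabTwist (ω^k·1) 1) (m+1) (m+1) (m₂+1) (m₃+1) ⟶ C` with `C > 0` — the TREE-LEVEL LIMIT of the `z^{k′} = 1` summands of `projSlabZ` at ONE box.
NOT here (honest scope): the closed form of `C` (lit-4 L24 `tendsto_laplaceMethod_sum_orbits_closedForm` + the Haar chart of `𝒢` + K8 determinants + B89 window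
constants = THE NUMBER, next), the `z^{k′} ≠ 1` summands (g0 `no_twistedFlat_slab_specialUnitary` ⇒ exponentially smaller), the `β → ∞` limit of
`projSlabDefect` (T1-tree-exact); anything UNIFORM in `β` (M3 = T1-box) or in `L, t` (M4 = T1); T1-box 0∕1, T1 proper 0∕1.

HONEST FRAMING: the classical (`β → ∞`) limit at ONE fixed box; nothing here bears on `IRcof`, `IR`, or the Yang–Mills mass gap (Clay: NOT proved); R4 =
`BalabanLadder.UV` only.  References: E. Hasenpflug, D. Rudolf, B. Sprungk (2024) §3.4, App. 4.1 Thm 16; C.-R. Hwang (1980); K. W. Breitung (1994) Thm 41, Thm 56;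
A. González-Arroyo (1998) §4.2; M. García Pérez, A. González-Arroyo, M. Okawa (2017) §2.2–§2.5.
-/

set_option autoImplicit false

noncomputable section

open scoped Matrix Matrix.Norms.Frobenius Topology ENNReal InnerProductSpace Pointwise
open MeasureTheory Filter NormedSpace Set Metric Module
open Literature.MathematicalPhysics.QuantumFieldTheory Literature.MathematicalPhysics.QuantumLattice
open Literature.Analysis.Asymptotics Literature.MeasureTheory.Group

namespace Summit.QuantumFields.YangMills.Cruxes.IRcof.TwistedSlab

variable {N : ℕ}

/-! ## §1 Small bookkeeping lemmas -/

section Prelim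

variable [NeZero N] {n₀ n₁ n₂ n₃ : ℕ} {L : FinTorusSite n₀ n₁ n₂ n₃ × Fin 4 → Matrix (Fin N) (Fin N) ℂ}
variable {M : Type*} [NormedAddCommGroup M] [InnerProductSpace ℝ M] [FiniteDimensional ℝ M] [MeasurableSpace M] [BorelSpace M]
variable {V : Type*} [NormedAddCommGroup V] [InnerProductSpace ℝ V] [FiniteDimensional ℝ V] [MeasurableSpace V] [BorelSpace V]

/-- The fibred chart density is non-negative everywhere (a product of absolute values and an `ENNReal.toReal`). [folklore] -/
theorem fibredChartDensity_nonneg (hL : ∀ e, L e ∈ Matrix.specialUnitaryGroup (Fin N) ℂ)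
    (D : (suFields N n₀ n₁ n₂ n₃ × realCoulombSlice L) ≃L[ℝ] (Fin 4 → suFields N n₀ n₁ n₂ n₃))
    (T : WithLp 2 (M × V) ≃L[ℝ] (suFields N n₀ n₁ n₂ n₃ × realCoulombSlice L))
    (μ : Measure (FinTorusSite n₀ n₁ n₂ n₃ × Fin 4 → Matrix.specialUnitaryGroup (Fin N) ℂ)) (w : M × V) :
    0 ≤ fibredChartDensity hL D T μ w := by
  unfold fibredChartDensity sliceChartDensity
  exact mul_nonneg (abs_nonneg _) (mul_nonneg ENNReal.toReal_nonneg (abs_nonneg _))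

omit [FiniteDimensional ℝ M] [MeasurableSpace M] [BorelSpace M] [FiniteDimensional ℝ V] [MeasurableSpace V] [BorelSpace V] [NeZero N] in
/-- The fibred chart at the origin is the background: `Ψ(0) = σ 0`. [folklore] -/
theorem fibredChartMap_prodFrame_zero (hL : ∀ e, L e ∈ Matrix.specialUnitaryGroup (Fin N) ℂ) (T_M : M ≃L[ℝ] suFields N n₀ n₁ n₂ n₃)
    (T_V : V ≃L[ℝ] realCoulombSlice L) : fibredChartMap hL (prodFrame T_M T_V) 0 = sliceCfg hL (T_V 0) := by
  rw [show (0 : M × V) = ((0 : M), (0 : V)) from rfl, fibredChartMap_prodFrame, map_zero, expGauge_zero, gaugeAct_one]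

omit [FiniteDimensional ℝ V] [MeasurableSpace V] [BorelSpace V] [NeZero N] in
/-- **The phase along the transversal is K19's slice phase**: `twistedExponent k (σ(T_V y)) = slicePhase (↑L) T_V k y`. [folklore] -/
theorem twistedExponent_sliceCfg_eq_slicePhase (hL : ∀ e, L e ∈ Matrix.specialUnitaryGroup (Fin N) ℂ) (k : ZMod N) (T_V : V ≃L[ℝ] realCoulombSlice L)
    (y : V) : twistedExponent k (sliceCfg hL (T_V y)) =
      slicePhase (fun e => (⟨L e, hL e⟩ : Matrix.specialUnitaryGroup (Fin N) ℂ)) T_V k y := by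
  rw [twistedExponent_sliceCfg]; rfl

omit [NeZero N] in
/-- Positivity bookkeeping: the integral over a ball of a non-negative function, continuous and positive at the centre, is positive. [folklore] -/
theorem setIntegral_ball_pos {g : M → ℝ} {ρ : ℝ} (hρ : 0 < ρ) (hg0 : ∀ z ∈ ball (0 : M) ρ, 0 ≤ g z)
    (hgc : ContinuousOn g (closedBall (0 : M) ρ)) (hg00 : 0 < g 0) : 0 < ∫ z in ball (0 : M) ρ, g z ∂volume := by
  have hgi : IntegrableOn g (ball (0 : M) ρ) volume := (hgc.integrableOn_compact (isCompact_closedBall _ _)).mono_set ball_subset_closedBall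
  obtain ⟨δ, hδ, hδg⟩ := Metric.continuousAt_iff.1 (hgc.continuousAt (closedBall_mem_nhds (0 : M) hρ)) (g 0 / 2) (by positivity)
  have hδ'pos : 0 < min δ ρ := lt_min hδ hρ
  have hsub : ball (0 : M) (min δ ρ) ⊆ ball 0 ρ := ball_subset_ball (min_le_right _ _)
  have hlow : ∀ z ∈ ball (0 : M) (min δ ρ), g 0 / 2 ≤ g z := by
    intro z hz
    have h := hδg (lt_of_lt_of_le (mem_ball.1 hz) (min_le_left _ _))
    rw [Real.dist_eq] at h
    linarith [(abs_lt.1 h).1]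
  have hfin : volume (ball (0 : M) (min δ ρ)) ≠ ∞ := (measure_ball_lt_top).ne
  have hμ : 0 < (volume : Measure M).real (ball (0 : M) (min δ ρ)) := ENNReal.toReal_pos (measure_ball_pos volume (0 : M) hδ'pos).ne' hfin
  have h1 : g 0 / 2 * (volume : Measure M).real (ball (0 : M) (min δ ρ)) ≤ ∫ z in ball (0 : M) (min δ ρ), g z ∂volume := by
    have h := setIntegral_mono_on (integrableOn_const hfin) (hgi.mono_set hsub) measurableSet_ball hlow
    rwa [setIntegral_const, smul_eq_mul, mul_comm] at h
  have h2 : (∫ z in ball (0 : M) (min δ ρ), g z ∂volume) ≤ ∫ z in ball (0 : M) ρ, g z ∂volume :=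
    setIntegral_mono_set hgi (ae_restrict_of_forall_mem measurableSet_ball hg0) (Eventually.of_forall hsub)
  have h0 : 0 < g 0 / 2 * (volume : Measure M).real (ball (0 : M) (min δ ρ)) := by positivity
  linarith

end Prelim

/-! ## §2 Laplace's method on the `N²` critical orbits of the twisted slab exponent -/

section Main

variable [NeZero N] {m m₂ m₃ : ℕ}
variable {M : Type*} [NormedAddCommGroup M] [InnerProductSpace ℝ M] [FiniteDimensional ℝ M] [MeasurableSpace M] [BorelSpace M]
variable {V : Type*} [NormedAddCommGroup V] [InnerProductSpace ℝ V] [FiniteDimensional ℝ V] [MeasurableSpace V] [BorelSpace V]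

/-- ★★★ **LAPLACE'S METHOD ON THE `N²` CRITICAL GAUGE ORBITS OF THE TWISTED SLAB EXPONENT** (one box; the compact ∕ continuous edition L23 fed by name).
`SU(N)`, generating twist `k`, reference pair `B A B⁻¹ A⁻¹ = ω^k·1`, box `(m+1)² × (m₂+1) × (m₃+1)` with `N(m+1) ≥ 2`; a frame `T_M` of the gauge algebra,
frames `T_V (i, j)` of the real Coulomb slices of the `N²` decorated ladders by one inner-product model `V`; `φ` continuous and gauge invariant.  Then
`β^{dim V/2} ∫ e^{−β·twistedExponent k U} φ(U) dU ⟶ Σ_{(i,j)} (2π)^{dim V/2} · ν(𝒢) · ((∫_{ball ρ_{ij}} J_{ij}(z,0) dz) ∕ ν(((e(ball ρ_{ij}))·Z_N)⁻¹)) · φ(ladder_{ij}) ∕ √det A_{ij}`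
for some radii `ρ_{ij} > 0` (`dU` = product Haar probability, `ν` = product Haar probability of the gauge group, `e = expGauge ∘ T_M`, `J_{ij}` = K17's fibred chart
density, `A_{ij}` = K19's slice Hessian). [cite: HasenpflugRudolfSprungk2024, §3.4 and App. 4.1 Thm 16 ∕ Remark 17] [cite: Hwang1980, main theorem]
[cite: Breitung1994, Thm 56 (6.31) with Thm 41 p. 56] [cite: Gonzalezarroyo1998, §4.2] -/
theorem tendsto_laplace_sum_orbits_twistedExponent {k : ZMod N} (hk : IsUnit k) {A B : Matrix.specialUnitaryGroup (Fin N) ℂ}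
    (hAB : B * A * B⁻¹ * A⁻¹ = (suCenter N k : Matrix.specialUnitaryGroup (Fin N) ℂ)) (hNm : 2 ≤ N * (m + 1))
    (T_M : M ≃L[ℝ] suFields N (m + 1) (m + 1) (m₂ + 1) (m₃ + 1))
    (T_V : ∀ p : ZMod N × ZMod N, V ≃L[ℝ] realCoulombSlice (ladderField (n₀ := m + 1) (n₁ := m + 1) (n₂ := m₂ + 1) (n₃ := m₃ + 1)
      ![(A : Matrix (Fin N) (Fin N) ℂ), (B : Matrix (Fin N) (Fin N) ℂ), centerPhase N p.1 • (1 : Matrix (Fin N) (Fin N) ℂ), centerPhase N p.2 • (1 : Matrix (Fin N) (Fin N) ℂ)]))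
    {φ : (FinTorusSite (m + 1) (m + 1) (m₂ + 1) (m₃ + 1) × Fin 4 → Matrix.specialUnitaryGroup (Fin N) ℂ) → ℝ} (hφ : Continuous φ)
    (hφinv : ∀ (g : FinTorusSite (m + 1) (m + 1) (m₂ + 1) (m₃ + 1) → Matrix.specialUnitaryGroup (Fin N) ℂ) U, φ (gaugeAct g U) = φ U) :
    ∃ ρ : ZMod N × ZMod N → ℝ, (∀ p, 0 < ρ p) ∧
      (∀ p, 0 < ∫ z in ball (0 : M) (ρ p), fibredChartDensity (ladderFieldPair_mem_specialUnitaryGroup A B p.1 p.2)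
          (slicePsiSuDeriv (Matrix.specialUnitaryGroup_le_unitaryGroup A.2) (Matrix.specialUnitaryGroup_le_unitaryGroup B.2)
            (isPrimitiveRoot_star_centerPhase (N := N) hk) (coe_mul_eq_smul_of_commutator_eq hAB) hNm (ladderFieldPair_mem_specialUnitaryGroup A B p.1 p.2))
          (prodFrame T_M (T_V p)) (Measure.pi fun _ => haarProbability (Matrix.specialUnitaryGroup (Fin N) ℂ)) (z, 0) ∂volume) ∧
      (∀ p, (Measure.pi fun _ : FinTorusSite (m + 1) (m + 1) (m₂ + 1) (m₃ + 1) => haarProbability (Matrix.specialUnitaryGroup (Fin N) ℂ))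
          (((fun z : M => expGauge (T_M z)) '' ball (0 : M) (ρ p)) *
            {g : FinTorusSite (m + 1) (m + 1) (m₂ + 1) (m₃ + 1) → Matrix.specialUnitaryGroup (Fin N) ℂ |
              ∃ c ∈ Subgroup.zpowers (suCenter N k : Matrix.specialUnitaryGroup (Fin N) ℂ), g = fun _ => c})⁻¹ ≠ 0 ∧
        (Measure.pi fun _ : FinTorusSite (m + 1) (m + 1) (m₂ + 1) (m₃ + 1) => haarProbability (Matrix.specialUnitaryGroup (Fin N) ℂ))
          (((fun z : M => expGauge (T_M z)) '' ball (0 : M) (ρ p)) *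
            {g : FinTorusSite (m + 1) (m + 1) (m₂ + 1) (m₃ + 1) → Matrix.specialUnitaryGroup (Fin N) ℂ |
              ∃ c ∈ Subgroup.zpowers (suCenter N k : Matrix.specialUnitaryGroup (Fin N) ℂ), g = fun _ => c})⁻¹ ≠ ∞) ∧
      Tendsto (fun β : ℝ => β ^ ((finrank ℝ V : ℝ) / 2) *
          ∫ U, Real.exp (-β * twistedExponent k U) * φ U ∂(Measure.pi fun _ => haarProbability (Matrix.specialUnitaryGroup (Fin N) ℂ))) atTop
        (𝓝 (∑ p : ZMod N × ZMod N, (2 * Real.pi) ^ ((finrank ℝ V : ℝ) / 2) *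
          ((Measure.pi fun _ : FinTorusSite (m + 1) (m + 1) (m₂ + 1) (m₃ + 1) => haarProbability (Matrix.specialUnitaryGroup (Fin N) ℂ)).real univ *
            ((∫ z in ball (0 : M) (ρ p), fibredChartDensity (ladderFieldPair_mem_specialUnitaryGroup A B p.1 p.2)
                (slicePsiSuDeriv (Matrix.specialUnitaryGroup_le_unitaryGroup A.2) (Matrix.specialUnitaryGroup_le_unitaryGroup B.2)
                  (isPrimitiveRoot_star_centerPhase (N := N) hk) (coe_mul_eq_smul_of_commutator_eq hAB) hNm (ladderFieldPair_mem_specialUnitaryGroup A B p.1 p.2))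
                (prodFrame T_M (T_V p)) (Measure.pi fun _ => haarProbability (Matrix.specialUnitaryGroup (Fin N) ℂ)) (z, 0) ∂volume) /
              ((Measure.pi fun _ : FinTorusSite (m + 1) (m + 1) (m₂ + 1) (m₃ + 1) => haarProbability (Matrix.specialUnitaryGroup (Fin N) ℂ))
                (((fun z : M => expGauge (T_M z)) '' ball (0 : M) (ρ p)) *
                  {g : FinTorusSite (m + 1) (m + 1) (m₂ + 1) (m₃ + 1) → Matrix.specialUnitaryGroup (Fin N) ℂ |
                    ∃ c ∈ Subgroup.zpowers (suCenter N k : Matrix.specialUnitaryGroup (Fin N) ℂ), g = fun _ => c})⁻¹).toReal *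
            φ (ladderConfig ![A, B, (suCenter N p.1 : Matrix.specialUnitaryGroup (Fin N) ℂ), (suCenter N p.2 : Matrix.specialUnitaryGroup (Fin N) ℂ)]) /
            Real.sqrt (LinearMap.det (sliceHessian (fun e => (⟨ladderField (n₀ := m + 1) (n₁ := m + 1) (n₂ := m₂ + 1) (n₃ := m₃ + 1)
              ![(A : Matrix (Fin N) (Fin N) ℂ), (B : Matrix (Fin N) (Fin N) ℂ), centerPhase N p.1 • (1 : Matrix (Fin N) (Fin N) ℂ),
                centerPhase N p.2 • (1 : Matrix (Fin N) (Fin N) ℂ)] e, ladderFieldPair_mem_specialUnitaryGroup A B p.1 p.2 e⟩ : Matrix.specialUnitaryGroup (Fin N) ℂ))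
              (T_V p) k)))))) := by
  classical
  have hAu : (A : Matrix (Fin N) (Fin N) ℂ) ∈ Matrix.unitaryGroup (Fin N) ℂ := Matrix.specialUnitaryGroup_le_unitaryGroup A.2
  have hBu : (B : Matrix (Fin N) (Fin N) ℂ) ∈ Matrix.unitaryGroup (Fin N) ℂ := Matrix.specialUnitaryGroup_le_unitaryGroup B.2
  have hω := isPrimitiveRoot_star_centerPhase (N := N) hk
  have hAB' := coe_mul_eq_smul_of_commutator_eq hAB
  have hL : ∀ p : ZMod N × ZMod N, ∀ e : FinTorusSite (m + 1) (m + 1) (m₂ + 1) (m₃ + 1) × Fin 4,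
      ladderField ![(A : Matrix (Fin N) (Fin N) ℂ), (B : Matrix (Fin N) (Fin N) ℂ), centerPhase N p.1 • (1 : Matrix (Fin N) (Fin N) ℂ),
        centerPhase N p.2 • (1 : Matrix (Fin N) (Fin N) ℂ)] e ∈ Matrix.specialUnitaryGroup (Fin N) ℂ :=
    fun p => ladderFieldPair_mem_specialUnitaryGroup A B p.1 p.2
  -- the chart data of every orbit (K20a)
  choose r hr hinj hJc hmeas hchart using fun p : ZMod N × ZMod N =>
    exists_ball_prod_hloc_ladder (M := M) (V := V) hAu hBu hω hAB' hNm (hL p) (prodFrame T_M (T_V p))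
      (Measure.pi fun _ => haarProbability (Matrix.specialUnitaryGroup (Fin N) ℂ))
  -- the chart is open at the origin (K22)
  have hΘ'𝓝 : ∀ p : ZMod N × ZMod N, 𝓝 ((fun (p : ZMod N × ZMod N) (y : V) => sliceCfg (hL p) (T_V p y)) p 0) ≤
      map (fibredChartMap (hL p) (prodFrame T_M (T_V p))) (𝓝 0) := by
    intro p
    obtain ⟨W, -, hW0, hW⟩ := exists_isOpen_forall_nhds_le_map_fibredChartMap hAu hBu hω hAB' hNm (hL p) (prodFrame T_M (T_V p))
    have h := hW 0 hW0
    rwa [fibredChartMap_prodFrame_zero] at h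
  -- the box `closedBall (r/2) × {0}` inside the product window
  have hρW : ∀ p : ZMod N × ZMod N, closedBall (0 : M) (r p / 2) ×ˢ {(0 : V)} ⊆ ball (0 : M) (r p) ×ˢ ball (0 : V) (r p) := by
    rintro p ⟨z, y⟩ ⟨hz, hy⟩
    rw [mem_singleton_iff] at hy
    subst hy
    exact ⟨closedBall_subset_ball (by linarith [hr p]) hz, mem_ball_self (hr p)⟩
  -- stabiliser
  have hstab : ∀ (p : ZMod N × ZMod N) (g : FinTorusSite (m + 1) (m + 1) (m₂ + 1) (m₃ + 1) → Matrix.specialUnitaryGroup (Fin N) ℂ),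
      gaugeAct g ((fun (p : ZMod N × ZMod N) (y : V) => sliceCfg (hL p) (T_V p y)) p 0) =
        (fun (p : ZMod N × ZMod N) (y : V) => sliceCfg (hL p) (T_V p y)) p 0 →
      g ∈ (fun _ : ZMod N × ZMod N => {g : FinTorusSite (m + 1) (m + 1) (m₂ + 1) (m₃ + 1) → Matrix.specialUnitaryGroup (Fin N) ℂ |
        ∃ c ∈ Subgroup.zpowers (suCenter N k : Matrix.specialUnitaryGroup (Fin N) ℂ), g = fun _ => c}) p := by
    intro p g hg
    simp only [map_zero, sliceCfg_zero_eq_ladderConfig] at hg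
    exact mem_constCenterGauge_of_gaugeAct_ladder_eq hk hAB p.1 p.2 g hg
  -- the Peano expansion along the transversal (K19)
  have hS2 : ∀ p : ZMod N × ZMod N, (fun y : V => twistedExponent k ((fun (p : ZMod N × ZMod N) (y : V) => sliceCfg (hL p) (T_V p y)) p y) -
      twistedExponent k ((fun (p : ZMod N × ZMod N) (y : V) => sliceCfg (hL p) (T_V p y)) p 0) -
      (1 / 2) * ⟪sliceHessian (fun e => (⟨ladderField (n₀ := m + 1) (n₁ := m + 1) (n₂ := m₂ + 1) (n₃ := m₃ + 1)
        ![(A : Matrix (Fin N) (Fin N) ℂ), (B : Matrix (Fin N) (Fin N) ℂ), centerPhase N p.1 • (1 : Matrix (Fin N) (Fin N) ℂ),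
          centerPhase N p.2 • (1 : Matrix (Fin N) (Fin N) ℂ)] e, hL p e⟩ : Matrix.specialUnitaryGroup (Fin N) ℂ)) (T_V p) k y, y⟫_ℝ) =o[𝓝 0]
      fun y => ‖y‖ ^ 2 := by
    intro p
    have h := isLittleO_slicePhase_taylor_two (fun e => (⟨ladderField (n₀ := m + 1) (n₁ := m + 1) (n₂ := m₂ + 1) (n₃ := m₃ + 1)
      ![(A : Matrix (Fin N) (Fin N) ℂ), (B : Matrix (Fin N) (Fin N) ℂ), centerPhase N p.1 • (1 : Matrix (Fin N) (Fin N) ℂ),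
        centerPhase N p.2 • (1 : Matrix (Fin N) (Fin N) ℂ)] e, hL p e⟩ : Matrix.specialUnitaryGroup (Fin N) ℂ)) (T_V p) k
      (twistedExponent_mk_ladderFieldPair hk hAB p.1 p.2 (hL p))
    refine h.congr' (Eventually.of_forall fun y => ?_) EventuallyEq.rfl
    simp only [twistedExponent_sliceCfg_eq_slicePhase]
  -- values at the vacua, the zero set, distinct orbits (K9, K2)
  have hf₀ : ∀ p : ZMod N × ZMod N, twistedExponent k ((fun (p : ZMod N × ZMod N) (y : V) => sliceCfg (hL p) (T_V p y)) p 0) = 0 := by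
    intro p
    simp only [map_zero, sliceCfg_zero_eq_ladderConfig]
    exact twistedExponent_ladderConfig_pair hk hAB p.1 p.2
  have hzero : ∀ U : FinTorusSite (m + 1) (m + 1) (m₂ + 1) (m₃ + 1) × Fin 4 → Matrix.specialUnitaryGroup (Fin N) ℂ, twistedExponent k U = 0 →
      ∃ (p : ZMod N × ZMod N) (g : FinTorusSite (m + 1) (m + 1) (m₂ + 1) (m₃ + 1) → Matrix.specialUnitaryGroup (Fin N) ℂ),
        gaugeAct g ((fun (p : ZMod N × ZMod N) (y : V) => sliceCfg (hL p) (T_V p y)) p 0) = U := by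
    intro U hU
    obtain ⟨g, i, j, rfl⟩ := (twistedExponent_eq_zero_iff hk hAB U).1 hU
    exact ⟨(i, j), g, by simp only [map_zero, sliceCfg_zero_eq_ladderConfig]⟩
  have hdist : ∀ p q : ZMod N × ZMod N, p ≠ q → ∀ g : FinTorusSite (m + 1) (m + 1) (m₂ + 1) (m₃ + 1) → Matrix.specialUnitaryGroup (Fin N) ℂ,
      gaugeAct g ((fun (p : ZMod N × ZMod N) (y : V) => sliceCfg (hL p) (T_V p y)) p 0) ≠
        (fun (p : ZMod N × ZMod N) (y : V) => sliceCfg (hL p) (T_V p y)) q 0 := by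
    intro p q hpq g h
    apply hpq
    simp only [map_zero, sliceCfg_zero_eq_ladderConfig] at h
    have h' : gaugeAct g (ladderConfig ![A, B, (suCenter N p.1 : Matrix.specialUnitaryGroup (Fin N) ℂ), (suCenter N p.2 : Matrix.specialUnitaryGroup (Fin N) ℂ)]) =
        gaugeAct 1 (ladderConfig ![A, B, (suCenter N q.1 : Matrix.specialUnitaryGroup (Fin N) ℂ), (suCenter N q.2 : Matrix.specialUnitaryGroup (Fin N) ℂ)]) := by
      rw [gaugeAct_one]; exact h
    obtain ⟨hi, hj, -⟩ := ladder_pair_labels_unique_specialUnitary hk hAB h'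
    exact Prod.ext (suCenter_coe_injective hi).symm (suCenter_coe_injective hj).symm
  have hfix : ∀ (p : ZMod N × ZMod N), ∀ s ∈ (fun _ : ZMod N × ZMod N => {g : FinTorusSite (m + 1) (m + 1) (m₂ + 1) (m₃ + 1) → Matrix.specialUnitaryGroup (Fin N) ℂ |
      ∃ c ∈ Subgroup.zpowers (suCenter N k : Matrix.specialUnitaryGroup (Fin N) ℂ), g = fun _ => c}) p, ∀ y : V,
      gaugeAct s ((fun (p : ZMod N × ZMod N) (y : V) => sliceCfg (hL p) (T_V p y)) p y) = (fun (p : ZMod N × ZMod N) (y : V) => sliceCfg (hL p) (T_V p y)) p y :=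
    fun p s hs y => gaugeAct_eq_self_of_mem_constCenterGauge hs _
  have hIpos : ∀ p : ZMod N × ZMod N, 0 < ∫ z in ball (0 : M) (r p / 2), fibredChartDensity (hL p) (slicePsiSuDeriv hAu hBu hω hAB' hNm (hL p))
      (prodFrame T_M (T_V p)) (Measure.pi fun _ => haarProbability (Matrix.specialUnitaryGroup (Fin N) ℂ)) (z, 0) ∂volume := by
    intro p
    have hcont : ContinuousOn ((fibredChartDensity (hL p) (slicePsiSuDeriv hAu hBu hω hAB' hNm (hL p)) (prodFrame T_M (T_V p))
        (Measure.pi fun _ => haarProbability (Matrix.specialUnitaryGroup (Fin N) ℂ))) ∘ fun z : M => (z, (0 : V))) (closedBall (0 : M) (r p / 2)) :=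
      (hJc p).comp (continuous_id.prodMk continuous_const).continuousOn fun z hz => hρW p ⟨hz, rfl⟩
    exact setIntegral_ball_pos (half_pos (hr p)) (fun z _ => fibredChartDensity_nonneg _ _ _ _ _) hcont
      (fibredChartDensity_zero_pos_ladder hAu hBu hω hAB' hNm (hL p) (prodFrame T_M (T_V p)) _)
  have hc : ∀ p : ZMod N × ZMod N,
      (Measure.pi fun _ : FinTorusSite (m + 1) (m + 1) (m₂ + 1) (m₃ + 1) => haarProbability (Matrix.specialUnitaryGroup (Fin N) ℂ))
          (((fun z : M => expGauge (T_M z)) '' ball (0 : M) (r p / 2)) *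
            {g : FinTorusSite (m + 1) (m + 1) (m₂ + 1) (m₃ + 1) → Matrix.specialUnitaryGroup (Fin N) ℂ |
              ∃ c ∈ Subgroup.zpowers (suCenter N k : Matrix.specialUnitaryGroup (Fin N) ℂ), g = fun _ => c})⁻¹ ≠ 0 ∧
        (Measure.pi fun _ : FinTorusSite (m + 1) (m + 1) (m₂ + 1) (m₃ + 1) => haarProbability (Matrix.specialUnitaryGroup (Fin N) ℂ))
          (((fun z : M => expGauge (T_M z)) '' ball (0 : M) (r p / 2)) *
            {g : FinTorusSite (m + 1) (m + 1) (m₂ + 1) (m₃ + 1) → Matrix.specialUnitaryGroup (Fin N) ℂ |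
              ∃ c ∈ Subgroup.zpowers (suCenter N k : Matrix.specialUnitaryGroup (Fin N) ℂ), g = fun _ => c})⁻¹ ≠ ∞ := fun p =>
    measure_windowConst_ne_zero_of_chart (act := gaugeAct) (σ := (fun (p : ZMod N × ZMod N) (y : V) => sliceCfg (hL p) (T_V p y)) p)
      (e := fun z : M => expGauge (T_M z)) (Θ' := fibredChartMap (hL p) (prodFrame T_M (T_V p)))
      continuous_gaugeAct_uncurry (fun g g' U => gaugeAct_mul g g' U) (fun U => gaugeAct_one U)
      ((continuous_sliceCfg (hL p)).comp (T_V p).continuous) (by simp only [map_zero, expGauge_zero]) (nhds_one_le_map_expGauge_comp T_M)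
      (fun z y => fibredChartMap_prodFrame (hL p) T_M (T_V p) z y) (hΘ'𝓝 p)
      ((isOpen_ball.prod isOpen_ball).mem_nhds ⟨mem_ball_self (hr p), mem_ball_self (hr p)⟩) (hinj p) (hstab p) (hfix p)
      (ball_mem_nhds (0 : M) (half_pos (hr p)))
  refine ⟨fun p => r p / 2, fun p => half_pos (hr p), hIpos, hc, ?_⟩
  have hmain := tendsto_laplaceMethod_sum_orbits_of_continuous (ι := ZMod N × ZMod N)
    (K := FinTorusSite (m + 1) (m + 1) (m₂ + 1) (m₃ + 1) → Matrix.specialUnitaryGroup (Fin N) ℂ)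
    (X := FinTorusSite (m + 1) (m + 1) (m₂ + 1) (m₃ + 1) × Fin 4 → Matrix.specialUnitaryGroup (Fin N) ℂ) (Z := M) (V := V)
    (act := gaugeAct) (σ := fun (p : ZMod N × ZMod N) (y : V) => sliceCfg (hL p) (T_V p y)) (e := fun z : M => expGauge (T_M z))
    (Θ := fun (p : ZMod N × ZMod N) (q : (FinTorusSite (m + 1) (m + 1) (m₂ + 1) (m₃ + 1) → Matrix.specialUnitaryGroup (Fin N) ℂ) × V) =>
      gaugeAct q.1 (sliceCfg (hL p) (T_V p q.2)))
    (Θ' := fun p : ZMod N × ZMod N => fibredChartMap (hL p) (prodFrame T_M (T_V p)))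
    (S := fun _ : ZMod N × ZMod N => {g : FinTorusSite (m + 1) (m + 1) (m₂ + 1) (m₃ + 1) → Matrix.specialUnitaryGroup (Fin N) ℂ |
      ∃ c ∈ Subgroup.zpowers (suCenter N k : Matrix.specialUnitaryGroup (Fin N) ℂ), g = fun _ => c})
    (ν := Measure.pi fun _ : FinTorusSite (m + 1) (m + 1) (m₂ + 1) (m₃ + 1) => haarProbability (Matrix.specialUnitaryGroup (Fin N) ℂ))
    (μ := Measure.pi fun _ : FinTorusSite (m + 1) (m + 1) (m₂ + 1) (m₃ + 1) × Fin 4 => haarProbability (Matrix.specialUnitaryGroup (Fin N) ℂ))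
    (κ := (volume : Measure M))
    (W := fun p : ZMod N × ZMod N => ball (0 : M) (r p) ×ˢ ball (0 : V) (r p))
    (J := fun p : ZMod N × ZMod N => fibredChartDensity (hL p) (slicePsiSuDeriv hAu hBu hω hAB' hNm (hL p)) (prodFrame T_M (T_V p))
      (Measure.pi fun _ : FinTorusSite (m + 1) (m + 1) (m₂ + 1) (m₃ + 1) × Fin 4 => haarProbability (Matrix.specialUnitaryGroup (Fin N) ℂ)))
    (ρ := fun p : ZMod N × ZMod N => r p / 2)
    (f := twistedExponent k) (φ := φ)
    (A := fun p : ZMod N × ZMod N => sliceHessian (fun e => (⟨ladderField (n₀ := m + 1) (n₁ := m + 1) (n₂ := m₂ + 1) (n₃ := m₃ + 1)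
      ![(A : Matrix (Fin N) (Fin N) ℂ), (B : Matrix (Fin N) (Fin N) ℂ), centerPhase N p.1 • (1 : Matrix (Fin N) (Fin N) ℂ),
        centerPhase N p.2 • (1 : Matrix (Fin N) (Fin N) ℂ)] e, hL p e⟩ : Matrix.specialUnitaryGroup (Fin N) ℂ)) (T_V p) k)
    (f₀ := 0)
    continuous_gaugeAct_uncurry (fun g g' U => gaugeAct_mul g g' U) (fun U => gaugeAct_one U)
    (fun g => measurePreserving_gaugeAct_of_isHaarMeasure g _)
    (fun p => (continuous_sliceCfg (hL p)).comp (T_V p).continuous) (continuous_expGauge.comp T_M.continuous)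
    (by simp only [map_zero, expGauge_zero]) (nhds_one_le_map_expGauge_comp T_M)
    (fun p g y => rfl) (fun p z y => fibredChartMap_prodFrame (hL p) T_M (T_V p) z y) hΘ'𝓝
    (fun p => isOpen_ball.prod isOpen_ball) hinj hJc (fun p w _ => fibredChartDensity_nonneg (hL p) _ _ _ w) hchart
    (fun p => half_pos (hr p)) hρW hstab hfix
    (continuous_twistedExponent k) hφ (fun g U => twistedExponent_gaugeAct k g U) hφinv
    (fun p => sliceHessian_isSymmetric (fun e => (⟨ladderField (n₀ := m + 1) (n₁ := m + 1) (n₂ := m₂ + 1) (n₃ := m₃ + 1) ![(A : Matrix (Fin N) (Fin N) ℂ), (B : Matrix (Fin N) (Fin N) ℂ), centerPhase N p.1 • (1 : Matrix (Fin N) (Fin N) ℂ), centerPhase N p.2 • (1 : Matrix (Fin N) (Fin N) ℂ)] e, hL p e⟩ : Matrix.specialUnitaryGroup (Fin N) ℂ)) (T_V p) k)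
    (fun p y hy => sliceHessian_pos hk hNm _ (twistedExponent_mk_ladderFieldPair hk hAB p.1 p.2 (hL p)) (T_V p) hy)
    hS2 hf₀ (fun U => twistedExponent_nonneg k U) hzero hdist
  simp only [sub_zero, map_zero, sliceCfg_zero_eq_ladderConfig] at hmain
  exact hmain

/-! ## §3 T1-TREE at one box: the twisted partition function at large `β` -/

/-- ★★★ **T1-TREE (ONE BOX): THE TREE-LEVEL LIMIT OF THE MAGNETICALLY TWISTED `SU(N)` SLAB PARTITION FUNCTION.**  For `SU(N)`, a generating twist
`k`, any box `(m+1)² × (m₂+1) × (m₃+1)` with `N(m+1) ≥ 2` and any frames as above: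
`β^{dim V/2} · W{ω^k·1, 1}(β; box) ⟶ C(box)` as `β → ∞` with `C(box) > 0` — `W` the tree's `wilsonFinTorusTensorTwistedPartition` of the
fundamental representation with 't Hooft's magnetic slab twist (the `z^{k′} = 1` summands of `projSlabZ`), through K9's `rfl` link.  This is the CLASSICAL LIMIT at a fixed
box; nothing uniform in `β`, `L`, `t`. [cite: HasenpflugRudolfSprungk2024, App. 4.1 Thm 16] [cite: Hwang1980, main theorem] [cite: Gonzalezarroyo1998, §4.2] -/
theorem tendsto_rpow_mul_twistedPartition_slab {k : ZMod N} (hk : IsUnit k) {A B : Matrix.specialUnitaryGroup (Fin N) ℂ}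
    (hAB : B * A * B⁻¹ * A⁻¹ = (suCenter N k : Matrix.specialUnitaryGroup (Fin N) ℂ)) (hNm : 2 ≤ N * (m + 1))
    (T_M : M ≃L[ℝ] suFields N (m + 1) (m + 1) (m₂ + 1) (m₃ + 1))
    (T_V : ∀ p : ZMod N × ZMod N, V ≃L[ℝ] realCoulombSlice (ladderField (n₀ := m + 1) (n₁ := m + 1) (n₂ := m₂ + 1) (n₃ := m₃ + 1)
      ![(A : Matrix (Fin N) (Fin N) ℂ), (B : Matrix (Fin N) (Fin N) ℂ), centerPhase N p.1 • (1 : Matrix (Fin N) (Fin N) ℂ), centerPhase N p.2 • (1 : Matrix (Fin N) (Fin N) ℂ)])) :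
    ∃ C : ℝ, 0 < C ∧ Tendsto (fun β : ℝ => β ^ ((finrank ℝ V : ℝ) / 2) *
      wilsonFinTorusTensorTwistedPartition (fundamentalRep (Fin N)) β (slabTwist (suCenter N k : Matrix.specialUnitaryGroup (Fin N) ℂ) 1)
        (m + 1) (m + 1) (m₂ + 1) (m₃ + 1)) atTop (𝓝 C) := by
  obtain ⟨ρ, -, hI, hc, hlim⟩ := tendsto_laplace_sum_orbits_twistedExponent (M := M) (V := V) hk hAB hNm T_M T_V
    (φ := fun _ => (1 : ℝ)) continuous_const (fun _ _ => rfl)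
  refine ⟨_, ?_, hlim.congr' (Eventually.of_forall fun β => ?_)⟩
  swap
  · simp only [mul_one, wilsonFinTorusTensorTwistedPartition_slab_fundamental]
  · refine Finset.sum_pos (fun p _ => ?_) Finset.univ_nonempty
    have hcp : 0 < ((Measure.pi fun _ : FinTorusSite (m + 1) (m + 1) (m₂ + 1) (m₃ + 1) => haarProbability (Matrix.specialUnitaryGroup (Fin N) ℂ))
        (((fun z : M => expGauge (T_M z)) '' ball (0 : M) (ρ p)) *
          {g : FinTorusSite (m + 1) (m + 1) (m₂ + 1) (m₃ + 1) → Matrix.specialUnitaryGroup (Fin N) ℂ |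
            ∃ c ∈ Subgroup.zpowers (suCenter N k : Matrix.specialUnitaryGroup (Fin N) ℂ), g = fun _ => c})⁻¹).toReal :=
      ENNReal.toReal_pos (hc p).1 (hc p).2
    have hIp := hI p
    have hν : 0 < (Measure.pi fun _ : FinTorusSite (m + 1) (m + 1) (m₂ + 1) (m₃ + 1) => haarProbability (Matrix.specialUnitaryGroup (Fin N) ℂ)).real univ := by
      rw [probReal_univ]; exact one_pos
    have hdet : 0 < LinearMap.det (sliceHessian (fun e => (⟨ladderField (n₀ := m + 1) (n₁ := m + 1) (n₂ := m₂ + 1) (n₃ := m₃ + 1)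
        ![(A : Matrix (Fin N) (Fin N) ℂ), (B : Matrix (Fin N) (Fin N) ℂ), centerPhase N p.1 • (1 : Matrix (Fin N) (Fin N) ℂ),
          centerPhase N p.2 • (1 : Matrix (Fin N) (Fin N) ℂ)] e, ladderFieldPair_mem_specialUnitaryGroup A B p.1 p.2 e⟩ : Matrix.specialUnitaryGroup (Fin N) ℂ))
        (T_V p) k) :=
      det_pos_of_inner_pos (sliceHessian_isSymmetric (fun e => (⟨ladderField (n₀ := m + 1) (n₁ := m + 1) (n₂ := m₂ + 1) (n₃ := m₃ + 1) ![(A : Matrix (Fin N) (Fin N) ℂ), (B : Matrix (Fin N) (Fin N) ℂ), centerPhase N p.1 • (1 : Matrix (Fin N) (Fin N) ℂ), centerPhase N p.2 • (1 : Matrix (Fin N) (Fin N) ℂ)] e, ladderFieldPair_mem_specialUnitaryGroup A B p.1 p.2 e⟩ : Matrix.specialUnitaryGroup (Fin N) ℂ)) (T_V p) k)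
        (fun y hy => sliceHessian_pos hk hNm (fun e => (⟨ladderField (n₀ := m + 1) (n₁ := m + 1) (n₂ := m₂ + 1) (n₃ := m₃ + 1) ![(A : Matrix (Fin N) (Fin N) ℂ), (B : Matrix (Fin N) (Fin N) ℂ), centerPhase N p.1 • (1 : Matrix (Fin N) (Fin N) ℂ), centerPhase N p.2 • (1 : Matrix (Fin N) (Fin N) ℂ)] e, ladderFieldPair_mem_specialUnitaryGroup A B p.1 p.2 e⟩ : Matrix.specialUnitaryGroup (Fin N) ℂ))
          (twistedExponent_mk_ladderFieldPair hk hAB p.1 p.2 (ladderFieldPair_mem_specialUnitaryGroup A B p.1 p.2)) (T_V p) hy)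
    have hsq : 0 < Real.sqrt (LinearMap.det (sliceHessian (fun e => (⟨ladderField (n₀ := m + 1) (n₁ := m + 1) (n₂ := m₂ + 1) (n₃ := m₃ + 1)
        ![(A : Matrix (Fin N) (Fin N) ℂ), (B : Matrix (Fin N) (Fin N) ℂ), centerPhase N p.1 • (1 : Matrix (Fin N) (Fin N) ℂ),
          centerPhase N p.2 • (1 : Matrix (Fin N) (Fin N) ℂ)] e, ladderFieldPair_mem_specialUnitaryGroup A B p.1 p.2 e⟩ : Matrix.specialUnitaryGroup (Fin N) ℂ))
        (T_V p) k)) := Real.sqrt_pos.2 hdet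
    positivity

end Main

end Summit.QuantumFields.YangMills.Cruxes.IRcof.TwistedSlab

end
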